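import Literature.AlgebraicGeometry.CossartPiltant200819.LocalModels2008
import Literature.AlgebraicGeometry.CossartPiltant200819.Ramification2008
import Literature.AlgebraicGeometry.Resolution.CofinalityFromPrincipalization
import Literature.AlgebraicGeometry.Resolution.QuasiExcellentLocalization
import Literature.AlgebraicGeometry.Resolution.FieldsJ2
import Literature.AlgebraicGeometry.Resolution.ExcellentRingsFieldProofs
import Literature.AlgebraicGeometry.Resolution.AffineDomainDimension
import Literature.AlgebraicGeometry.Resolution.ArithmeticalThreefolds
import Literature.AlgebraicGeometry.Resolution.Principalization
import HarnessLib

/-!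
# Cossart–Piltant 2008, Cor. 4.6 verbatim: cofinality of local uniformizations

[CP-I] = V. Cossart, O. Piltant, *Resolution of singularities of threefolds in positive
characteristic I*, J. Algebra 320 (2008) (HAL hal-00139124).  This file types Corollary 4.6
VERBATIM in the §3 dictionary of `LocalModels2008.lean` (`IsLocalModelOf`,
`IsLocalUniformizationOf`) as the named statement `CofinalityOfLocalUniformizations` and PROVES
it along the printed proof from the principalization theorem [CP-I] Prop. 4.2 = [CP-II]
Prop. 4.4 (the named fact `CossartPiltant2019Principalization` of `Principalization.lean`, as
everywhere in this directory): `cofinalityOfLocalUniformizations_of_principalization`.  So far the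
tree had Cor. 4.6 only as the abstract node `Skeleton2008.cor46_of_nodes` and as the
affine-model "climbing" engine of `Resolution/CofinalityFromPrincipalization*.lean` (relative
frame over a regular local base `S`); here the statement is the printed one, over a ground
field `k`.

PRINTED TEXT (HAL p. 14):

> "Corollary 4.6. Let `K/k` be a function field of transcendence degree three and `V/k` be a
> valuation ring with `QF(V) = K` having a local uniformization `R`. Then for any local model `R₀`
> of `V/k`, there exists a local uniformization `R₁` of `V/k` such that `R₀ < R₁`.
> Proof. Let `A₀ := k[x₁, ..., xₙ]` be an affine model of `V/k` such that `R₀` is the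
> localization of `A₀` at some prime ideal. Write `xᵢ = fᵢ/gᵢ`, with `fᵢ, gᵢ ∈ R`, `gᵢ ≠ 0`. By
> proposition 4.2, with `X := Spec R` and `I := (fᵢ, gᵢ)`, there exists an iterated monoidal
> transform `R′` of `R` along `V` such that `xᵢ ∈ R′`. By induction on `n`, it can then be
> assumed that `A₀ ⊆ R′`. Then take `R₁ := R′`."

DICTIONARY (declarations of `LocalModels2008.lean` and of
`Literature/AlgebraicGeometry/Resolution`):
* "function field `K/k` of transcendence degree three" = `(⊤ : IntermediateField k K).FG` and
  `Algebra.trdeg k K = 3`; "valuation ring `V/k` with `QF(V) = K`" = `O : ValuationSubring K`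
  with `k ⊆ O`;
* "local model `R₀` of `V/k`", "local uniformization `R` of `V/k`" = `IsLocalModelOf k K O R₀`,
  `IsLocalUniformizationOf k K O R` ([CP-I] §3, HAL p. 4: a local model is the localization
  `(A₀)_𝔭 ⊆ K` of an affine model `A₀ ⊆ V` at the centre `𝔭 = 𝔪_V ∩ A₀`, as the set of fractions
  `a/s`, `a, s ∈ A₀`, `V(s) = 0`; a local uniformization is a regular local model);
* "`R₀ < R₁`" ([CP-I] §3: inclusion with domination) = `R₀ ≤ R₁`; domination is AUTOMATIC for two
  local models of the same `V` (`IsLocalModelOf.inv_mem_iff_inv_mem_of_le`: a non-zero element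
  of `R₀` is a unit of `R₁` iff it is a unit of `R₀` iff `V(x) = 0`,
  `IsLocalModelOf.inv_mem_iff_valuation_eq_one`);
* "By proposition 4.2, with `X := Spec R` and `I := (fᵢ, gᵢ)` … an iterated monoidal transform
  `R′` of `R` along `V` such that `xᵢ ∈ R′`" = `exists_affineModel_regular_mem_of_principalization`:
  principalization `CossartPiltant2019Principalization` of the ideal sheaf `(a, b)`
  (`Scheme.IdealSheafData.ofIdealTop (Ideal.span {a, b})`) on the regular three-dimensional
  excellent affine scheme `Spec A[f⁻¹]`, `D(f) ⊆ Reg A` a basic open neighbourhood of the centre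
  of `V` on the affine model `A` of `R = A_𝔭` (`isRegularRing_adjoin_insert_inv`; the regular
  locus is open since fields are J-2, `isOpen_regularLocus_of_finiteType_field`), by a sequence
  of blowing ups along regular centres (`IsRegularCentreBlowupSeq`, proper birational with
  regular source: `IsRegularCentreBlowupSeq.isResolution`), followed along `V` to the centre
  `x′` of `V` on the last blow up, whose local ring `R′ = 𝒪_{X(n),x′} ↪ V` contains `a/b`
  (`exists_fg_regular_mem_of_isResolution`, `CofinalityFromPrincipalization.lean`); the output is
  the affine avatar: `A ⊆ A′ ⊆ V` finitely generated, regular at the centre, `xᵢ = y/s` with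
  `y, s ∈ A′`, `V(s) = 0`;
* "By induction on `n`" = `exists_affineModel_regular_forall_mem_of_principalization`
  (`Finset.induction_on` over the generators of `A₀`);
* "take `R₁ := R′`" = `R₁ := A′_{𝔪_V ∩ A′}` with its description as fractions
  (`exists_isLocalUniformizationOf_coe_eq`, the construction of
  `LocalModels2008.exists_isLocalUniformizationOf`), which contains `R₀ = (A₀)_{𝔪_V ∩ A₀}` as
  soon as it contains `A₀` (`le_of_coe_eq_of_le`).

CONTENTS (all PROVED, `0` sorries):
* `ringKrullDim_eq_of_fg_of_trdeg_eq`, `exists_mul_pow_mem_of_mem_adjoin_insert_inv`,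
  `isRegularRing_adjoin_insert_inv` (the regular chart `k[s₀][f⁻¹]`, identified inside `K` with
  Mathlib's `Localization.subalgebra.ofField K (powers f)`);
* `exists_affineModel_regular_mem_of_principalization` (one element),
  `exists_affineModel_regular_forall_mem_of_principalization` (finitely many);
* `exists_isLocalUniformizationOf_coe_eq`, `IsLocalModelOf.inv_mem_iff_valuation_eq_one`,
  `IsLocalModelOf.inv_mem_iff_inv_mem_of_le`, `le_of_coe_eq_of_le`;
* `CofinalityOfLocalUniformizations` — **Cor. 4.6 VERBATIM** (a `Prop` definition) — and
  `cofinalityOfLocalUniformizations_of_principalization :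
  CossartPiltant2019Principalization → CofinalityOfLocalUniformizations`;
* `cofinalityOfLocalUniformizations_of_cossartPiltant2019LU3` — the same conclusion from the
  relative local uniformization `CossartPiltant2019LU3` proved in [CP-II] (2019), which does not
  even use the given local uniformization `R`;
* `cofinalityOfLocalUniformizations_iff_cofinality`, `cofinality_of_principalization :
  CossartPiltant2019Principalization → Cofinality`, `cofinality_of_cossartPiltant2019LU3` — the
  DISCHARGE, modulo Prop. 4.2, of the leaf `Cofinality` of `Ramification2008.lean` (see below).

RELATION TO `CP2008.Cofinality` (`Ramification2008.lean`).  Cor. 4.6 was already typed verbatim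
there, as the NAMED FACT `Cofinality` with the hypothesis "having a local uniformization" in the
tree's idiom `Resolution.IsLocallyUniformizable k K O`, and is consumed as the hypothesis `hcof`
of the reduction to Artin–Schreier coverings (`NormalModelAbove2008`, `StableModelCriterion2008`,
`ConjugateStability2008`, `PrimaryContraction2008`, `TamePrimeDescentAssembly2008`).  The present
`CofinalityOfLocalUniformizations` is the same sentence with that hypothesis in the §3 dictionary
(`∃ R, IsLocalUniformizationOf k K O R`, "having a local uniformization `R`"); the two are
EQUIVALENT by the proved bridge `isLocallyUniformizable_iff_exists_isLocalUniformizationOf`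
(`cofinalityOfLocalUniformizations_iff_cofinality`), and the leaf `Cofinality` is thereby PROVED
from `CossartPiltant2019Principalization` (`cofinality_of_principalization`) and from
`CossartPiltant2019LU3` (`cofinality_of_cossartPiltant2019LU3`): every `hcof` binder of the files
above can be instantiated by `cofinality_of_principalization hP`.

DEVIATIONS, recorded not hidden: (a) Prop. 4.2 enters as the named fact
`CossartPiltant2019Principalization` ([CP-II] Prop. 4.4, typed for regular excellent integral
Noetherian schemes of dimension exactly three); (b) accordingly it is applied to the regular
affine chart `Spec A[f⁻¹] ⊇ Spec R` (dimension `3 = trdeg_k K`) and not to "`X := Spec R`"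
(`R = A_𝔭` has dimension `< 3` when the centre `𝔭` of `V` on `A` is not a closed point); the
blown-up local ring along `V` is the same; (c) "`R₀ < R₁`" is rendered `R₀ ≤ R₁`, domination being
a theorem (`IsLocalModelOf.inv_mem_iff_inv_mem_of_le`).

CAVEAT.  Kernel-checked rendering of one printed statement and proof against the tree's
definitions, modulo the named principalization fact.  AI-written; weaker than expert review.
NOT summit progress.
-/

noncomputable section

open CategoryTheory CategoryTheory.Limits AlgebraicGeometry TopologicalSpace IsLocalRing

universe u

namespace Literature.AlgebraicGeometry.CossartPiltant200819.CP2008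

open Literature.AlgebraicGeometry.Resolution Scheme.IdealSheafData

/-! ## Affine models: the regular chart `A[f⁻¹]` and the principalization step -/

section AffineModels

variable {k K : Type u} [Field k] [Field K] [Algebra k K]

/-- The Krull dimension of an affine model of `K/k` equals `trdeg_k K`.
[cite: Matsumura1987, Thm. 5.6] -/
theorem ringKrullDim_eq_of_fg_of_trdeg_eq (A : Subalgebra k K) (hfg : A.FG) [IsFractionRing A K]
    {d : ℕ} (hd : Algebra.trdeg k K = d) : ringKrullDim A = d := by
  haveI : Algebra.FiniteType k A := A.fg_iff_finiteType.mp hfg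
  obtain ⟨n, hn, htr⟩ := exists_ringKrullDim_eq_and_trdeg_eq k A
  rw [trdeg_eq_trdeg_of_isFractionRing A, htr] at hd
  rw [hn]
  exact_mod_cast hd

/-- Elements of `k[s₀, f⁻¹]` are fractions `a / fⁿ` with `a ∈ k[s₀]` (for `f ∈ k[s₀]`, `f ≠ 0`).
[folklore] -/
theorem exists_mul_pow_mem_of_mem_adjoin_insert_inv (s₀ : Set K) {f : K}
    (hf : f ∈ Algebra.adjoin k s₀) (hf0 : f ≠ 0) {z : K}
    (hz : z ∈ Algebra.adjoin k (insert f⁻¹ s₀)) :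
    ∃ n : ℕ, z * f ^ n ∈ Algebra.adjoin k s₀ := by
  induction hz using Algebra.adjoin_induction with
  | mem x hx =>
    rcases Set.mem_insert_iff.mp hx with rfl | hx
    · exact ⟨1, by rw [pow_one, inv_mul_cancel₀ hf0]; exact Subalgebra.one_mem _⟩
    · exact ⟨0, by rw [pow_zero, mul_one]; exact Algebra.subset_adjoin hx⟩
  | algebraMap c => exact ⟨0, by rw [pow_zero, mul_one]; exact Subalgebra.algebraMap_mem _ c⟩
  | add x y _ _ hx hy =>
    obtain ⟨m, hm⟩ := hx
    obtain ⟨n, hn⟩ := hy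
    refine ⟨m + n, ?_⟩
    have : (x + y) * f ^ (m + n) = x * f ^ m * f ^ n + y * f ^ n * f ^ m := by ring
    rw [this]
    exact Subalgebra.add_mem _ (Subalgebra.mul_mem _ hm (Subalgebra.pow_mem _ hf n))
      (Subalgebra.mul_mem _ hn (Subalgebra.pow_mem _ hf m))
  | mul x y _ _ hx hy =>
    obtain ⟨m, hm⟩ := hx
    obtain ⟨n, hn⟩ := hy
    refine ⟨m + n, ?_⟩
    have : x * y * f ^ (m + n) = x * f ^ m * (y * f ^ n) := by ring
    rw [this]
    exact Subalgebra.mul_mem _ hm hn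

/-- **`k[s₀][f⁻¹]` is regular when `D(f) ⊆ Reg(k[s₀])`**: inside `K`, `k[s₀, f⁻¹]` coincides with
Mathlib's localization `Localization.subalgebra.ofField K (powers f)` of `A = k[s₀]`, whose primes
are the primes of `A` not containing `f`, with the same local rings
(`mem_regularLocus_iff_comap_of_isLocalization`). [folklore] -/
theorem isRegularRing_adjoin_insert_inv (s₀ : Set K) (f : Algebra.adjoin k s₀)
    (hf0 : (f : K) ≠ 0) [IsFractionRing (Algebra.adjoin k s₀) K]
    [IsNoetherianRing (Algebra.adjoin k s₀)]
    (hreg : (PrimeSpectrum.basicOpen f : Set (PrimeSpectrum (Algebra.adjoin k s₀))) ⊆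
      regularLocus (Algebra.adjoin k s₀)) :
    IsRegularRing (Algebra.adjoin k (insert (f : K)⁻¹ s₀)) := by
  classical
  have hf0' : f ≠ 0 := fun h => hf0 (by rw [h]; rfl)
  have hS : Submonoid.powers f ≤ nonZeroDivisors (Algebra.adjoin k s₀) :=
    powers_le_nonZeroDivisors_of_noZeroDivisors hf0'
  let B : Subalgebra (Algebra.adjoin k s₀) K :=
    Localization.subalgebra.ofField K (Submonoid.powers f) hS
  haveI : IsLocalization (Submonoid.powers f) B :=
    Localization.subalgebra.isLocalization_ofField K (Submonoid.powers f) hS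
  haveI hNB : IsNoetherianRing B :=
    IsLocalization.isNoetherianRing (Submonoid.powers f) B inferInstance
  have hregB : IsRegularRing B := by
    refine isRegularRing_iff.mpr fun Q hQ => ?_
    have h1 := (mem_regularLocus_iff_comap_of_isLocalization (Submonoid.powers f)
      (⟨Q, hQ⟩ : PrimeSpectrum B)).mpr (hreg ?_)
    · exact h1
    · change f ∉ Ideal.comap (algebraMap (Algebra.adjoin k s₀) B) Q
      intro hmem
      exact hQ.ne_top (Ideal.eq_top_of_isUnit_mem _ (Ideal.mem_comap.mp hmem)
        (IsLocalization.map_units B ⟨f, Submonoid.mem_powers f⟩))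
  -- the two subalgebras of `K` have the same elements
  have hmem : ∀ x : K, x ∈ Algebra.adjoin k (insert (f : K)⁻¹ s₀) ↔ x ∈ B := by
    intro x
    have hB : x ∈ B ↔ ∃ (a s : Algebra.adjoin k s₀) (_ : s ∈ Submonoid.powers f),
        x = algebraMap (Algebra.adjoin k s₀) K a * (algebraMap (Algebra.adjoin k s₀) K s)⁻¹ :=
      Iff.rfl
    rw [hB]
    constructor
    · intro hx
      obtain ⟨n, hn⟩ := exists_mul_pow_mem_of_mem_adjoin_insert_inv s₀ f.2 hf0 hx
      refine ⟨⟨x * (f : K) ^ n, hn⟩, f ^ n, ⟨n, rfl⟩, ?_⟩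
      change x = x * (f : K) ^ n * (((f ^ n : Algebra.adjoin k s₀) : K))⁻¹
      rw [SubmonoidClass.coe_pow, mul_inv_cancel_right₀ (pow_ne_zero n hf0)]
    · rintro ⟨a, s, ⟨n, rfl⟩, rfl⟩
      change (a : K) * (((f ^ n : Algebra.adjoin k s₀) : K))⁻¹ ∈ _
      rw [SubmonoidClass.coe_pow, ← inv_pow]
      exact Subalgebra.mul_mem _ (Algebra.adjoin_mono (Set.subset_insert _ _) a.2)
        (Subalgebra.pow_mem _ (Algebra.subset_adjoin (Set.mem_insert _ _)) n)
  let e : Algebra.adjoin k (insert (f : K)⁻¹ s₀) ≃+* B :=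
    { toFun := fun x => ⟨x, (hmem x).1 x.2⟩
      invFun := fun y => ⟨y, (hmem y).2 y.2⟩
      left_inv := fun _ => rfl
      right_inv := fun _ => rfl
      map_mul' := fun _ _ => rfl
      map_add' := fun _ _ => rfl }
  haveI := hregB
  exact IsRegularRing.of_ringEquiv e.symm

/-- **The one-element step of [CoP1] Cor. 4.6** (HAL p. 14, proof: "we take `X := Spec R` and
`I := (fᵢ, gᵢ)` in proposition 4.2 to get … `xᵢ ∈ R′`"), from Cossart–Piltant's principalization
(`CossartPiltant2019Principalization`). Let `A ⊆ O` be an affine model of `K/k`, `trdeg_k K = 3`,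
regular at the centre `𝔭 = 𝔪_O ∩ A` of the valuation ring `O`, and `x ∈ O`. Since the regular locus
of `A` is open (fields are J-2) there is `f ∈ A ∖ 𝔭` with `D(f) ⊆ Reg A`; the model
`A₁ = A[f⁻¹] ⊆ O` is regular, excellent, three-dimensional, with the same local ring at the centre.
Write `x = a/b`, `a, b ∈ A₁`, principalize `(a, b)` on `Spec A₁` by blowing ups along regular
centres (`σ` proper birational with regular source, `IsRegularCentreBlowupSeq.isResolution`) and
follow `O` to its centre on the blown-up model (`exists_fg_regular_mem_of_isResolution`): the
affine neighbourhood gives `A ⊆ A' ⊆ O` finitely generated, regular at the centre of `O`, with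
`x = y/s`, `y, s ∈ A'`, `s ∈ O^×`. [cite: CossartPiltant2008, Cor. 4.6 (HAL p. 14)] -/
theorem exists_affineModel_regular_mem_of_principalization
    (hP : CossartPiltant2019Principalization.{u}) (htr : Algebra.trdeg k K = 3)
    (O : ValuationSubring K) (A : Subalgebra k K) (hAO : A.toSubring ≤ O.toSubring) (hfg : A.FG)
    (hfr : IsFractionRing A K)
    (hreg : IsRegularLocalRing (Localization.AtPrime (centreIdeal A O hAO)))
    {x : K} (hx : x ∈ O) :
    ∃ (A' : Subalgebra k K) (h' : A'.toSubring ≤ O.toSubring), A ≤ A' ∧ A'.FG ∧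
      IsRegularLocalRing (Localization.AtPrime (centreIdeal A' O h')) ∧
      ∃ y s : K, y ∈ A' ∧ s ∈ A' ∧ O.valuation s = 1 ∧ x * s = y := by
  classical
  haveI := hfr
  haveI hft : Algebra.FiniteType k A := A.fg_iff_finiteType.mp hfg
  haveI : IsNoetherianRing A := Algebra.FiniteType.isNoetherianRing k A
  -- a basic open neighbourhood `D(f)` of the centre inside the (open) regular locus
  have hopen : IsOpen (regularLocus A) := isOpen_regularLocus_of_finiteType_field k A
  let P : PrimeSpectrum A := ⟨centreIdeal A O hAO, inferInstance⟩
  have hPreg : P ∈ regularLocus A := hreg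
  obtain ⟨U, ⟨f, rfl⟩, hfP, hfU⟩ :=
    PrimeSpectrum.isTopologicalBasis_basic_opens.exists_subset_of_mem_open hPreg hopen
  have hfP' : f ∉ centreIdeal A O hAO := hfP
  have hvf : O.valuation (f : K) = 1 := by
    have hle : O.valuation (f : K) ≤ 1 := O.valuation_le_one ⟨f, hAO f.2⟩
    have hnlt : ¬ O.valuation (f : K) < 1 := fun hlt =>
      hfP' ((ValuationSubring.valuation_lt_one_iff O ⟨(f : K), hAO f.2⟩).mpr hlt)
    exact le_antisymm hle (not_lt.mp hnlt)
  have hf0 : (f : K) ≠ 0 := by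
    intro h
    rw [h, map_zero] at hvf
    exact zero_ne_one hvf
  have hfinvO : (f : K)⁻¹ ∈ O := by
    rw [← ValuationSubring.valuation_le_one_iff, map_inv₀, hvf, inv_one]
  -- the model `A₁ = k[s₀, f⁻¹]`
  obtain ⟨s₀, rfl⟩ := hfg
  obtain ⟨s₁, hs₁⟩ : ∃ s₁ : Set K, s₁ = insert (f : K)⁻¹ (s₀ : Set K) := ⟨_, rfl⟩
  have hle : Algebra.adjoin k (s₀ : Set K) ≤ Algebra.adjoin k s₁ := by
    rw [hs₁]; exact Algebra.adjoin_mono (Set.subset_insert _ _)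
  let OA : Subalgebra k K :=
    { carrier := (O : Set K)
      mul_mem' := fun ha hb => O.toSubring.mul_mem ha hb
      one_mem' := O.toSubring.one_mem
      add_mem' := fun ha hb => O.toSubring.add_mem ha hb
      zero_mem' := O.toSubring.zero_mem
      algebraMap_mem' := fun c => hAO ((Algebra.adjoin k (s₀ : Set K)).algebraMap_mem c) }
  have hA₁O : (Algebra.adjoin k s₁).toSubring ≤ O.toSubring := by
    have h1 : Algebra.adjoin k s₁ ≤ OA := by
      rw [hs₁]
      refine Algebra.adjoin_le ?_
      rintro z (rfl | hz)
      · exact hfinvO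
      · exact hAO (Algebra.subset_adjoin hz)
    exact fun z hz => h1 hz
  haveI hfr₁ : IsFractionRing (Algebra.adjoin k s₁) K :=
    isFractionRing_of_le hle hfr
  have hfg₁ : (Algebra.adjoin k s₁).FG := ⟨insert (f : K)⁻¹ s₀, by rw [Finset.coe_insert, hs₁]⟩
  haveI : Algebra.FiniteType k (Algebra.adjoin k s₁) :=
    (Algebra.adjoin k s₁).fg_iff_finiteType.mp hfg₁
  haveI : IsNoetherianRing (Algebra.adjoin k s₁) :=
    Algebra.FiniteType.isNoetherianRing k (Algebra.adjoin k s₁)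
  have hregA₁ : IsRegularRing (Algebra.adjoin k s₁) := by
    rw [hs₁]
    exact isRegularRing_adjoin_insert_inv (s₀ : Set K) f hf0 hfU
  -- `Spec A₁` satisfies the hypotheses of principalization
  haveI : IsDomain (CommRingCat.of (Algebra.adjoin k s₁)) :=
    (inferInstance : IsDomain (Algebra.adjoin k s₁))
  haveI : IsNoetherianRing (CommRingCat.of (Algebra.adjoin k s₁)) :=
    (inferInstance : IsNoetherianRing (Algebra.adjoin k s₁))
  haveI : IsRegularRing (CommRingCat.of (Algebra.adjoin k s₁)) := hregA₁
  have hSreg : Scheme.IsRegular (Spec (.of (Algebra.adjoin k s₁))) := Scheme.isRegular_Spec _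
  have hSexc : Scheme.IsExcellent (Spec (.of (Algebra.adjoin k s₁))) :=
    Scheme.isExcellent_Spec_of_isExcellentRing (Algebra.adjoin k s₁)
      (isExcellentRing_of_finiteType_field k (Algebra.adjoin k s₁))
  have hSdim : topologicalKrullDim (Spec (.of (Algebra.adjoin k s₁))) = 3 := by
    change topologicalKrullDim (PrimeSpectrum (Algebra.adjoin k s₁)) = 3
    rw [PrimeSpectrum.topologicalKrullDim_eq_ringKrullDim]
    exact ringKrullDim_eq_of_fg_of_trdeg_eq (Algebra.adjoin k s₁) hfg₁ htr
  -- `x = a / b` on `A₁`, and the ideal sheaf `(a, b)`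
  obtain ⟨a, b, hb, hab⟩ := IsFractionRing.div_surjective (A := Algebra.adjoin k s₁) x
  have hb0 : b ≠ 0 := nonZeroDivisors.ne_zero hb
  have hxO : algebraMap (Algebra.adjoin k s₁) K a / algebraMap (Algebra.adjoin k s₁) K b ∈ O := by
    rw [hab]; exact hx
  let J : (Spec (.of (Algebra.adjoin k s₁))).IdealSheafData :=
    ofIdealTop (Ideal.span {(Scheme.ΓSpecIso (.of (Algebra.adjoin k s₁))).inv a,
      (Scheme.ΓSpecIso (.of (Algebra.adjoin k s₁))).inv b})
  have hJ : J ≠ ⊥ := by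
    intro hJ0
    have h1 : J.ideal ⟨⊤, isAffineOpen_top _⟩ = ⊥ := by
      rw [hJ0]
      rfl
    have h2 : (Scheme.ΓSpecIso (.of (Algebra.adjoin k s₁))).inv b ∈
        J.ideal ⟨⊤, isAffineOpen_top _⟩ := by
      change _ ∈ (ofIdealTop _).ideal _
      rw [Scheme.IdealSheafData.ofIdealTop_ideal]
      exact Ideal.mem_map_of_mem _ (Ideal.subset_span
        (Set.mem_insert_of_mem _ (Set.mem_singleton _)))
    rw [h1, Ideal.mem_bot] at h2
    apply hb0
    exact (ConcreteCategory.bijective_of_isIso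
      (Scheme.ΓSpecIso (.of (Algebra.adjoin k s₁))).inv).1 (h2.trans (map_zero _).symm)
  -- principalize and follow the valuation
  obtain ⟨X, σ, hseq, hprinc⟩ := hP (Spec (.of (Algebra.adjoin k s₁))) hSreg hSexc hSdim J hJ
  have hres : IsResolution σ := hseq.isResolution hJ hSreg
  obtain ⟨T, hTO, hTfg, hTreg, y, s, hy, hs, hvs, hxs⟩ :=
    exists_fg_regular_mem_of_isResolution (A := Algebra.adjoin k s₁) (K := K) O
      (fun a => hA₁O a.2) hres a b hb0 hxO hprinc
  rw [hab] at hxs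
  -- back to a `k`-subalgebra
  obtain ⟨t, ht⟩ := hTfg
  have e : (Algebra.adjoin k (s₁ ∪ (t : Set K))).toSubring = T.toSubring := by
    rw [Algebra.adjoin_union_eq_adjoin_adjoin, ← ht]
    rfl
  have h' : (Algebra.adjoin k (s₁ ∪ (t : Set K))).toSubring ≤ O.toSubring := by
    rw [e]; exact hTO
  refine ⟨Algebra.adjoin k (s₁ ∪ (t : Set K)), h',
    hle.trans (Algebra.adjoin_mono Set.subset_union_left),
    ⟨insert (f : K)⁻¹ s₀ ∪ t, by rw [Finset.coe_union, Finset.coe_insert, hs₁]⟩,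
    isRegularLocalRing_centre_of_toSubring_eq O _ h' hTO e hTreg, y, s, ?_, ?_, hvs, hxs⟩
  · show y ∈ (Algebra.adjoin k (s₁ ∪ (t : Set K))).toSubring
    rw [e]; exact hy
  · show s ∈ (Algebra.adjoin k (s₁ ∪ (t : Set K))).toSubring
    rw [e]; exact hs

/-- **Finitely many elements at once** (the induction "on `n`" of [CoP1] Cor. 4.6, HAL p. 14):
iterating `exists_affineModel_regular_mem_of_principalization`, an affine model `A ⊆ O` regular
at the centre of `O` is contained in one, `A' ⊆ O`, still finitely generated with `Frac = K` and
regular at the centre, over which every element of the finite set `c ⊆ O` is a fraction `y/s`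
with `s ∈ O^×`. [cite: CossartPiltant2008, Cor. 4.6 (HAL p. 14)] -/
theorem exists_affineModel_regular_forall_mem_of_principalization
    (hP : CossartPiltant2019Principalization.{u}) (htr : Algebra.trdeg k K = 3)
    (O : ValuationSubring K) (c : Finset K) (hc : ∀ x ∈ c, x ∈ O) :
    ∀ (A : Subalgebra k K) (hAO : A.toSubring ≤ O.toSubring), A.FG → IsFractionRing A K →
      IsRegularLocalRing (Localization.AtPrime (centreIdeal A O hAO)) →
      ∃ (A' : Subalgebra k K) (h' : A'.toSubring ≤ O.toSubring), A ≤ A' ∧ A'.FG ∧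
        IsFractionRing A' K ∧ IsRegularLocalRing (Localization.AtPrime (centreIdeal A' O h')) ∧
        ∀ x ∈ c, ∃ y s : K, y ∈ A' ∧ s ∈ A' ∧ O.valuation s = 1 ∧ x * s = y := by
  classical
  induction c using Finset.induction_on with
  | empty =>
    intro A hAO hfg hfr hreg
    exact ⟨A, hAO, le_rfl, hfg, hfr, hreg, fun x hx => absurd hx (Finset.notMem_empty x)⟩
  | insert x₀ c hx₀ ih =>
    intro A hAO hfg hfr hreg
    obtain ⟨A', h', hle, hfg', hfr', hreg', hall⟩ :=
      ih (fun x hx => hc x (Finset.mem_insert_of_mem hx)) A hAO hfg hfr hreg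
    obtain ⟨A'', h'', hle', hfg'', hreg'', y, s, hy, hs, hvs, hxs⟩ :=
      exists_affineModel_regular_mem_of_principalization hP htr O A' h' hfg' hfr' hreg'
        (hc x₀ (Finset.mem_insert_self _ _))
    refine ⟨A'', h'', hle.trans hle', hfg'', isFractionRing_of_le hle' hfr',
      hreg'', fun x hx => ?_⟩
    rcases Finset.mem_insert.mp hx with rfl | hx
    · exact ⟨y, s, hy, hs, hvs, hxs⟩
    · obtain ⟨y', s', hy', hs', hvs', hxs'⟩ := hall x hx
      exact ⟨y', s', hle' hy', hle' hs', hvs', hxs'⟩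

end AffineModels

/-! ## Cor. 4.6 verbatim, in the dictionary of `LocalModels2008` -/

/-- **[CoP1] Corollary 4.6, verbatim** (HAL p. 14): "Let `K/k` be a function field of
transcendence degree three and `V/k` be a valuation ring with `QF(V) = K` having a local
uniformization `R`. Then for any local model `R₀` of `V/k`, there exists a local uniformization
`R₁` of `V/k` such that `R₀ < R₁`." In the §3 dictionary of `LocalModels2008`
(`IsLocalModelOf`, `IsLocalUniformizationOf`; `V = O`, `k ⊆ O`, `QF(V) = K` automatic for a
valuation subring of `K`); `R₀ < R₁` (inclusion with domination) is rendered as `R₀ ≤ R₁`, the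
domination `𝔪_{R₁} ∩ R₀ = 𝔪_{R₀}` being automatic for two local models of the same `V`.
A `Prop` definition; proved from principalization in
`cofinalityOfLocalUniformizations_of_principalization`; EQUIVALENT to the earlier verbatim node
`Cofinality` of `Ramification2008.lean` (hypothesis phrased `IsLocallyUniformizable k K O`) by
`cofinalityOfLocalUniformizations_iff_cofinality`.
[cite: CossartPiltant2008, Cor. 4.6 (HAL p. 14)] -/
def CofinalityOfLocalUniformizations : Prop :=
  ∀ (k K : Type u) [Field k] [Field K] [Algebra k K], (⊤ : IntermediateField k K).FG →
    Algebra.trdeg k K = 3 → ∀ (O : ValuationSubring K), (∀ c : k, algebraMap k K c ∈ O) →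
      (∃ R : Subalgebra k K, IsLocalUniformizationOf k K O R) →
        ∀ R₀ : Subalgebra k K, IsLocalModelOf k K O R₀ →
          ∃ R₁ : Subalgebra k K, IsLocalUniformizationOf k K O R₁ ∧ R₀ ≤ R₁

section Proof

variable {k K : Type u} [Field k] [Field K] [Algebra k K] (O : ValuationSubring K)

/-- The local uniformization `R = A_𝔭 ⊆ K` of `O` on an affine model `A ⊆ O` regular at the centre
`𝔭 = 𝔪_O ∩ A`, together with its description as the ring of fractions `a/s`, `a, s ∈ A`,
`O(s) = 0` (the construction of `exists_isLocalUniformizationOf`). [folklore] -/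
theorem exists_isLocalUniformizationOf_coe_eq (A : Subalgebra k K)
    (hAO : A.toSubring ≤ O.toSubring) (hfg : A.FG) (hfrac : IsFractionRing A K)
    (hreg : IsRegularLocalRing (Localization.AtPrime (centreIdeal A O hAO))) :
    ∃ R : Subalgebra k K, IsLocalUniformizationOf k K O R ∧
      (R : Set K) = {x | ∃ a ∈ A, ∃ s ∈ A, O.valuation s = 1 ∧ x = a * s⁻¹} := by
  classical
  haveI := hfrac
  haveI : IsFractionRing A.toSubring K := isFractionRing_toSubring A
  set P := Ideal.comap (Subring.inclusion hAO) (IsLocalRing.maximalIdeal O) with hP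
  let R₁ : Subalgebra A.toSubring K :=
    Localization.subalgebra.ofField K P.primeCompl (Ideal.primeCompl_le_nonZeroDivisors _)
  have hR₁ : (R₁ : Set K) = {x | ∃ a ∈ A, ∃ s ∈ A, O.valuation s = 1 ∧ x = a * s⁻¹} :=
    coe_ofField_centre O A.toSubring hAO
  have hAR : ∀ a : K, a ∈ A → a ∈ R₁ := fun a ha => by
    rw [← SetLike.mem_coe, hR₁]
    exact ⟨a, ha, 1, A.one_mem, by simp, by simp⟩
  let R : Subalgebra k K :=
    { carrier := R₁
      mul_mem' := fun ha hb => R₁.mul_mem ha hb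
      one_mem' := R₁.one_mem
      add_mem' := fun ha hb => R₁.add_mem ha hb
      zero_mem' := R₁.zero_mem
      algebraMap_mem' := fun c => hAR _ (A.algebraMap_mem c) }
  have hR : (R : Set K) = {x | ∃ a ∈ A, ∃ s ∈ A, O.valuation s = 1 ∧ x = a * s⁻¹} := hR₁
  obtain ⟨e⟩ := nonempty_ringEquiv_localization_centre O A.toSubring hAO R.toSubring hR
  haveI : IsRegularLocalRing (Localization.AtPrime P) := hreg
  haveI : IsRegularLocalRing R.toSubring := IsRegularLocalRing.of_ringEquiv e
  exact ⟨R, ⟨⟨A, hfg, hfrac, hAO, hR⟩,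
    IsRegularLocalRing.of_ringEquiv (subalgebraRingEquivToSubring R).symm⟩, hR⟩

/-- **Domination of local models through the affine models**: if `R₁ = A′_{𝔭′}` and
`R₀ = (A₀)_{𝔭₀}` are local models of the same valuation ring `O` and `A₀ ⊆ R₁`, then `R₀ ⊆ R₁`
(a unit `s` of `O` lying in `R₁` is a unit of `R₁`). [folklore] -/
theorem le_of_coe_eq_of_le {A' A₀ R₁ R₀ : Subalgebra k K}
    (hR₁ : (R₁ : Set K) = {x | ∃ a ∈ A', ∃ s ∈ A', O.valuation s = 1 ∧ x = a * s⁻¹})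
    (hR₀ : (R₀ : Set K) = {x | ∃ a ∈ A₀, ∃ s ∈ A₀, O.valuation s = 1 ∧ x = a * s⁻¹})
    (hA₀ : A₀ ≤ R₁) : R₀ ≤ R₁ := by
  intro x hx
  have hx' : x ∈ (R₀ : Set K) := hx
  rw [hR₀] at hx'
  obtain ⟨a, ha, s, hs, hvs, rfl⟩ := hx'
  have hsR : s ∈ (R₁ : Set K) := hA₀ hs
  rw [hR₁] at hsR
  obtain ⟨y, hy, t, ht, hvt, hsyt⟩ := hsR
  have hvy : O.valuation y = 1 := by
    have h1 : O.valuation s = O.valuation y * (O.valuation t)⁻¹ := by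
      rw [hsyt, map_mul, map_inv₀]
    rw [hvt, inv_one, mul_one] at h1
    rw [← h1, hvs]
  have hsinv : s⁻¹ ∈ R₁ := by
    rw [← SetLike.mem_coe, hR₁]
    refine ⟨t, ht, y, hy, hvy, ?_⟩
    rw [hsyt, mul_inv, inv_inv, mul_comm]
  exact R₁.mul_mem (hA₀ ha) hsinv

/-- **Local models of `O` are dominated by `O`**: a non-zero element of a local model `R` of
`O` is invertible in `R` iff it is a unit of `O` (`O(x) = 0`). [folklore] -/
theorem IsLocalModelOf.inv_mem_iff_valuation_eq_one {R : Subalgebra k K}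
    (hR : IsLocalModelOf k K O R) {x : K} (hx : x ∈ R) (hx0 : x ≠ 0) :
    x⁻¹ ∈ R ↔ O.valuation x = 1 := by
  obtain ⟨A, -, -, hAO, hRc⟩ := hR
  have hRO : ∀ z ∈ R, O.valuation z ≤ 1 := by
    intro z hz
    have hz' : z ∈ (R : Set K) := hz
    rw [hRc] at hz'
    obtain ⟨a, ha, s, hs, hvs, rfl⟩ := hz'
    rw [map_mul, map_inv₀, hvs, inv_one, mul_one]
    exact O.valuation_le_one ⟨a, hAO ha⟩
  constructor
  · intro hinv
    have h1 : O.valuation x ≤ 1 := hRO x hx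
    have h2 : (O.valuation x)⁻¹ ≤ 1 := by
      have := hRO x⁻¹ hinv
      rwa [map_inv₀] at this
    have h0 : 0 < O.valuation x := by
      rw [zero_lt_iff]
      exact (Valuation.ne_zero_iff _).mpr hx0
    exact le_antisymm h1 ((inv_le_one₀ h0).mp h2)
  · intro hvx
    have hx' : x ∈ (R : Set K) := hx
    rw [hRc] at hx'
    obtain ⟨a, ha, s, hs, hvs, hxas⟩ := hx'
    have hva : O.valuation a = 1 := by
      have h1 : O.valuation x = O.valuation a * (O.valuation s)⁻¹ := by
        rw [hxas, map_mul, map_inv₀]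
      rw [hvs, inv_one, mul_one] at h1
      rw [← h1, hvx]
    rw [← SetLike.mem_coe, hRc]
    exact ⟨s, hs, a, ha, hva, by rw [hxas, mul_inv, inv_inv, mul_comm]⟩

/-- **`R₀ < R₁` is automatic from `R₀ ⊆ R₁`** for two local models of the same valuation ring
`O` (Cossart–Piltant 2008, §3: `<` denotes inclusion with domination): a non-zero element of `R₀`
is a unit of `R₁` iff it is a unit of `R₀`, both meaning that it is a unit of `O`. [folklore] -/
theorem IsLocalModelOf.inv_mem_iff_inv_mem_of_le {R₀ R₁ : Subalgebra k K}
    (h₀ : IsLocalModelOf k K O R₀) (h₁ : IsLocalModelOf k K O R₁) (hle : R₀ ≤ R₁)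
    {x : K} (hx : x ∈ R₀) (hx0 : x ≠ 0) : x⁻¹ ∈ R₁ ↔ x⁻¹ ∈ R₀ := by
  rw [h₁.inv_mem_iff_valuation_eq_one O (hle hx) hx0, h₀.inv_mem_iff_valuation_eq_one O hx hx0]

/-- **[CoP1] Corollary 4.6 from principalization** (HAL p. 14, printed proof: "Let
`A₀ := k[x₁, ..., xₙ]` be an affine model of `V/k` such that `R₀` is the localization of `A₀` at
some prime ideal. Write `xᵢ = fᵢ/gᵢ`, with `fᵢ, gᵢ ∈ R`, `gᵢ ≠ 0`. By proposition 4.2, with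
`X := Spec R` and `I := (fᵢ, gᵢ)`, there exists an iterated monoidal transform `R′` of `R` along
`V` such that `xᵢ ∈ R′`. By induction on `n`, it can then be assumed that `A₀ ⊆ R′`. Then take
`R₁ := R′`."). The principalization step is `exists_affineModel_regular_mem_of_principalization`
(applied on a regular affine chart `Spec A[f⁻¹]` of the affine model `A` of `R = A_𝔭` containing
the centre of `V`, rather than on `Spec R` itself, so that Cossart–Piltant's principalization of
three-dimensional regular excellent schemes, `CossartPiltant2019Principalization`, applies
literally), the induction on `n` is `exists_affineModel_regular_forall_mem_of_principalization`,
and `R₁ := A′_{𝔪_O ∩ A′}` (`exists_isLocalUniformizationOf_coe_eq`) contains `R₀` by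
`le_of_coe_eq_of_le`. [cite: CossartPiltant2008, Cor. 4.6 (HAL p. 14)]
[cite: CossartPiltant2019, Prop. 4.4 (arXiv v1: Prop. 4.3)] -/
theorem cofinalityOfLocalUniformizations_of_principalization
    (hP : CossartPiltant2019Principalization.{u}) : CofinalityOfLocalUniformizations.{u} := by
  intro k K _ _ _ _ htr O _ hLU R₀ hR₀
  classical
  obtain ⟨R, hR⟩ := hLU
  obtain ⟨A, hAO, hfg, hfrac, hreg⟩ := hR.isLocallyUniformizable O
  obtain ⟨A₀, hfg₀, hfrac₀, hA₀O, hR₀c⟩ := hR₀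
  obtain ⟨g₀, rfl⟩ := hfg₀
  obtain ⟨A', h', -, hfg', hfr', hreg', hall⟩ :=
    exists_affineModel_regular_forall_mem_of_principalization hP htr O g₀
      (fun x hx => hA₀O (Algebra.subset_adjoin hx)) A hAO hfg hfrac hreg
  obtain ⟨R₁, hR₁, hR₁c⟩ := exists_isLocalUniformizationOf_coe_eq O A' h' hfg' hfr' hreg'
  refine ⟨R₁, hR₁, le_of_coe_eq_of_le O hR₁c hR₀c (Algebra.adjoin_le fun g hg => ?_)⟩
  obtain ⟨y, s, hy, hs, hvs, hgs⟩ := hall g hg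
  have hs0 : s ≠ 0 := by
    rintro rfl
    rw [map_zero] at hvs
    exact zero_ne_one hvs
  show g ∈ (R₁ : Set K)
  rw [hR₁c]
  exact ⟨y, hy, s, hs, hvs, by rw [← hgs, mul_inv_cancel_right₀ hs0]⟩

/-- **[CoP1] Corollary 4.6 from Cossart–Piltant's relative local uniformization in dimension
three** (`CossartPiltant2019LU3`, the form of local uniformization proved in the 2019 paper:
every affine model `A₀ ⊆ O` is dominated by a finitely generated one regular at the centre of
`O`): then `R₁ := A′_{𝔪_O ∩ A′} ⊇ (A₀)_{𝔪_O ∩ A₀} = R₀`. In this form the hypothesis that `V` has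
some local uniformization is not even used. [cite: CossartPiltant2019, Thm. 1.1 with §4.1 (LU)] -/
theorem cofinalityOfLocalUniformizations_of_cossartPiltant2019LU3
    (h : CossartPiltant2019LU3.{u}) : CofinalityOfLocalUniformizations.{u} := by
  intro k K _ _ _ _ htr O _ _ R₀ hR₀
  classical
  obtain ⟨A₀, hfg₀, hfrac₀, hA₀O, hR₀c⟩ := hR₀
  haveI := hfrac₀
  obtain ⟨A', h', hle, hfg', hreg'⟩ :=
    h k K O A₀ hA₀O hfg₀ hfrac₀ (ringKrullDim_le_of_fg_of_trdeg_le A₀ hfg₀ htr.le)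
  obtain ⟨R₁, hR₁, hR₁c⟩ := exists_isLocalUniformizationOf_coe_eq O A' h' hfg'
    (isFractionRing_of_le hle hfrac₀) hreg'
  refine ⟨R₁, hR₁, le_of_coe_eq_of_le O hR₁c hR₀c fun a ha => ?_⟩
  show a ∈ (R₁ : Set K)
  rw [hR₁c]
  exact ⟨a, hle ha, 1, A'.one_mem, by simp, by simp⟩

end Proof

/-! ## Discharge of the leaf `Cofinality` of `Ramification2008.lean` -/

section Discharge

/-- The present file's `CofinalityOfLocalUniformizations` ("having a local uniformization `R`"
rendered `∃ R, IsLocalUniformizationOf k K O R`, §3 dictionary of `LocalModels2008`) and the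
verbatim node `Cofinality` of `Ramification2008.lean` (the same sentence with the hypothesis in
the tree's idiom `Resolution.IsLocallyUniformizable k K O`) are EQUIVALENT, by the proved bridge
`isLocallyUniformizable_iff_exists_isLocalUniformizationOf`. [folklore] -/
theorem cofinalityOfLocalUniformizations_iff_cofinality :
    CofinalityOfLocalUniformizations.{u} ↔ Cofinality.{u} := by
  refine ⟨fun h k K _ _ _ hfg htr O hk hLU R₀ hR₀ => ?_,
    fun h k K _ _ _ hfg htr O hk hLU R₀ hR₀ => ?_⟩
  · exact h k K hfg htr O hk
      ((isLocallyUniformizable_iff_exists_isLocalUniformizationOf O).mp hLU) R₀ hR₀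
  · exact h k K hfg htr O hk
      ((isLocallyUniformizable_iff_exists_isLocalUniformizationOf O).mpr hLU) R₀ hR₀

/-- **[CoP1] Corollary 4.6 as the leaf `Cofinality` of the reduction to Artin–Schreier and purely
inseparable coverings (`Ramification2008.lean`; the hypothesis `hcof` of
`TamePrimeDescentAssembly2008`, `PrimaryContraction2008`, `StableModelCriterion2008`,
`ConjugateStability2008`, `NormalModelAbove2008`), PROVED modulo [CoP1] Prop. 4.2**
(`CossartPiltant2019Principalization` = [CoP2] Prop. 4.4): the printed proof,
`cofinalityOfLocalUniformizations_of_principalization`, transported along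
`cofinalityOfLocalUniformizations_iff_cofinality`.
[cite: CossartPiltant2008, Cor. 4.6 (HAL p. 14)]
[cite: CossartPiltant2019, Prop. 4.4 (arXiv v1: Prop. 4.3)] -/
theorem cofinality_of_principalization (hP : CossartPiltant2019Principalization.{u}) :
    Cofinality.{u} :=
  cofinalityOfLocalUniformizations_iff_cofinality.mp
    (cofinalityOfLocalUniformizations_of_principalization hP)

/-- The leaf `Cofinality` of `Ramification2008.lean` from Cossart–Piltant's relative local
uniformization in dimension three, `CossartPiltant2019LU3` ([CoP2] Thm. 1.1, LU form).
[cite: CossartPiltant2019, Thm. 1.1 with §4.1 (LU)] -/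
theorem cofinality_of_cossartPiltant2019LU3 (h : CossartPiltant2019LU3.{u}) : Cofinality.{u} :=
  cofinalityOfLocalUniformizations_iff_cofinality.mp
    (cofinalityOfLocalUniformizations_of_cossartPiltant2019LU3 h)

end Discharge

end Literature.AlgebraicGeometry.CossartPiltant200819.CP2008

end
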